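import Literature.AnabelianGeometry.AbsoluteAnabelian.NeukirchUchidaRatCore
import Literature.NumberTheory.GaloisRepresentations.AbsDecompositionIndex
import Literature.NumberTheory.GaloisRepresentations.NeukirchUchidaKummerPackage
import Literature.NumberTheory.GaloisRepresentations.NeukirchUchidaKummerField
import Literature.AnabelianGeometry.AbsoluteAnabelian.NeukirchUchidaSeparationData
import HarnessLib

/-!
# The Neukirch–Uchida deduction, row R10b (part 2): movers and the separation of one pair

Cell abc-iut, layer L4, row «G-L4d2g4-1-NU-DEDUCTION» (sub-DAG `plan/L4/SUBDAG-NeukirchUchida.md`,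
row R10b = the discharger of the separation oracle `hsep` of
`NeukirchUchidaProof.existsUnique_forall_eq_conj_of_rows` / `neukirchUchida_of_rows`).

Contents (base field `ℚ`, `Γ = absoluteGaloisGroup ℚ`, `Γ_K = ΓK K`):

* `map_subgroupOf_restrict_of_le`, `map_subgroupOf_eq_of_forall_iff` — pure group bookkeeping:
  restricting an invariance `α(X ∩ U₁) = X ∩ U₂` to a subgroup `H ≤ U₁` on which `α` restricts, and
  passing from the elementwise dictionary `g ∈ X ↔ α g ∈ Y` (`g ∈ H`) to `α_H(X ∩ H) = Y ∩ H`.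
* `two_dvd_card_quot_sub_one` — a prime of `𝓞 M` above an odd rational prime has odd residue field.
* `exists_mover` — above such a prime, if `b ≡ t (mod P)` with `t` a non-square unit residue, an
  arithmetic Frobenius in `D_A ∩ Γ_M` moves every square root of `b` (Euler's criterion, via
  `smul_ne_self_of_sub_pow_mem_nonunits` and `exists_frobenius_of_below`).
* `pair_separation` — the separation `m⁻¹ m' ∈ Γ_M` for ONE pair of nonarchimedean primes `A, A'`
  of `ℚ̄` above two distinct odd rational primes splitting completely in the finite Galois `M`, given
  the correspondences `β_M(D_A ∩ Γ_M) = D_{m•A} ∩ Γ_M`, `β_M(D_{A'} ∩ Γ_M) = D_{m'•A'} ∩ Γ_M` and the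
  `β`-invariance of `Γ_L` for the finite Galois `L ⊇ M`: row R9
  (`inv_mul_mem_of_map_stabilizer_eq`, `ℓ = 2`, `ζ = -1`) fed with the Chinese-remainder element of
  `exists_crt_element`, the movers, and the Kummer field `M(√(Γ•b))` of abc-iut-w5-d047
  (`comap_fixingSubgroup_sup_adjoin_rootSetOfOrbit`, `relIndex_comap_fixingSubgroup_dvd`).

All statements are at `Γ`-level (subgroups of `absoluteGaloisGroup ℚ`), instance arguments over
`↥M` are passed explicitly where the `ℚ`-algebra diamond would bite.  Proofs only; no new
definitions.  References: [NSW2008, (12.1.9), (12.2.1)], [Neukirch1999, Ch. I §8, Ch. V §3].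
-/

noncomputable section

open scoped Pointwise NumberField
open Field NumberField IsDedekindDomain
open Literature.NumberTheory.GaloisRepresentations
open Literature.NumberTheory.GaloisRepresentations.NeukirchUchidaProof

namespace Literature.AnabelianGeometry.AbsoluteAnabelian

namespace NeukirchUchidaProof

/-! ### Restriction bookkeeping -/

section Restrict

variable {G : Type*} [Group G] {U₁ U₂ : Subgroup G}

/-- Restriction of an invariance `α(X ∩ U₁) = X ∩ U₂` to an invariant subgroup `H` on which `α`
restricts to `α_H`: `α_H(X ∩ H) = X ∩ H`. [cite: NeukirchSchmidtWingberg2008, Thm (12.2.1)] -/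
theorem map_subgroupOf_restrict_of_le (α : U₁ ≃* U₂) {H X : Subgroup G} (hH₁ : H ≤ U₁)
    (αH : H ≃* H) (hαHv : ∀ h : H, ((αH h : H) : G) = ((α ⟨(h : G), hH₁ h.2⟩ : U₂) : G))
    (hX : (X.subgroupOf U₁).map α.toMonoidHom = X.subgroupOf U₂) :
    (X.subgroupOf H).map αH.toMonoidHom = X.subgroupOf H := by
  ext v
  constructor
  · rintro ⟨u, hu, rfl⟩
    change ((αH u : H) : G) ∈ X
    rw [hαHv]
    have : α ⟨(u : G), hH₁ u.2⟩ ∈ (X.subgroupOf U₁).map α.toMonoidHom := ⟨⟨(u : G), hH₁ u.2⟩, hu, rfl⟩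
    rw [hX] at this
    exact this
  · intro hv
    refine ⟨αH.symm v, ?_, αH.apply_symm_apply v⟩
    change ((αH.symm v : H) : G) ∈ X
    -- `α (αH⁻¹ v) = v ∈ X`, so `αH⁻¹ v ∈ X` by `hX`
    have h1 : α ⟨((αH.symm v : H) : G), hH₁ (αH.symm v).2⟩ ∈ X.subgroupOf U₂ := by
      change ((α ⟨((αH.symm v : H) : G), hH₁ (αH.symm v).2⟩ : U₂) : G) ∈ X
      rw [← hαHv, αH.apply_symm_apply]
      exact hv
    rw [← hX] at h1
    obtain ⟨u, hu, huv⟩ := h1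
    rw [MulEquiv.coe_toMonoidHom] at huv
    have : (u : G) = ((αH.symm v : H) : G) := congrArg Subtype.val (α.injective huv)
    rw [← this]
    exact hu

/-- From the elementwise form «`g ∈ D_A ↔ α(g) ∈ D_B` for `g ∈ H`» to the subgroup form
`α_H(D_A ∩ H) = D_B ∩ H`. [cite: NeukirchSchmidtWingberg2008, Thm (12.2.1)] -/
theorem map_subgroupOf_eq_of_forall_iff (α : U₁ ≃* U₂) {H : Subgroup G} (hH₁ : H ≤ U₁)
    (αH : H ≃* H) (hαHv : ∀ h : H, ((αH h : H) : G) = ((α ⟨(h : G), hH₁ h.2⟩ : U₂) : G))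
    {X Y : Subgroup G} (h : ∀ (g : G) (hg : g ∈ H), g ∈ X ↔ ((α ⟨g, hH₁ hg⟩ : U₂) : G) ∈ Y) :
    (X.subgroupOf H).map αH.toMonoidHom = Y.subgroupOf H := by
  ext v
  constructor
  · rintro ⟨u, hu, rfl⟩
    change ((αH u : H) : G) ∈ Y
    rw [hαHv]
    exact (h u u.2).mp hu
  · intro hv
    refine ⟨αH.symm v, ?_, αH.apply_symm_apply v⟩
    change ((αH.symm v : H) : G) ∈ X
    rw [h _ (αH.symm v).2, ← hαHv, αH.apply_symm_apply]
    exact hv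

end Restrict

/-! ### Odd residue fields and movers -/

variable (M : IntermediateField ℚ (AlgebraicClosure ℚ)) [FiniteDimensional ℚ M]

/-- A prime `P` of `𝓞 M` over a prime `v₀` of `ℚ` not containing `2` does not contain `2`, and its
residue field has odd cardinality: `2 ∣ N(P) - 1`. [cite: NeukirchANT1999, Ch. I §8] -/
theorem two_dvd_card_quot_sub_one {v₀ : HeightOneSpectrum (𝓞 ℚ)} (h2 : (2 : 𝓞 ℚ) ∉ v₀.asIdeal)
    {P : Ideal (𝓞 M)} (hP : P ∈ v₀.asIdeal.primesOver (𝓞 M)) :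
    (2 : 𝓞 M) ∉ P ∧ 2 ∣ Nat.card (𝓞 M ⧸ P) - 1 := by
  haveI : NumberField M := numberField_intermediateField M
  haveI := hP.1
  haveI := hP.2
  have h2P : (2 : 𝓞 M) ∉ P := by
    intro h
    apply h2
    have : (algebraMap (𝓞 ℚ) (𝓞 M) 2) ∈ P := by rw [map_ofNat]; exact h
    rw [← Ideal.mem_comap] at this
    rw [Ideal.LiesOver.over (p := v₀.asIdeal) (P := P)]
    exact this
  refine ⟨h2P, ?_⟩
  haveI : P.IsMaximal := Ideal.isMaximal_of_mem_primesOver hP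
  have hPne : P ≠ ⊥ := Ring.ne_bot_of_isMaximal_of_not_isField inferInstance (RingOfIntegers.not_isField M)
  haveI : Finite (𝓞 M ⧸ P) := Ideal.finiteQuotientOfFreeOfNeBot P hPne
  letI := Fintype.ofFinite (𝓞 M ⧸ P)
  letI := Ideal.Quotient.field P
  obtain ⟨n, hp, hcard⟩ := FiniteField.card (𝓞 M ⧸ P) (ringChar (𝓞 M ⧸ P))
  rw [Nat.card_eq_fintype_card, hcard]
  -- the characteristic is odd
  have hodd : ¬ 2 ∣ ringChar (𝓞 M ⧸ P) := by
    intro hdvd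
    have h22 : ringChar (𝓞 M ⧸ P) = 2 :=
      ((Nat.prime_dvd_prime_iff_eq Nat.prime_two hp).mp hdvd).symm
    apply h2P
    have h20 : ((2 : ℕ) : 𝓞 M ⧸ P) = 0 := by
      have := ringChar.spec (𝓞 M ⧸ P) 2
      rw [h22] at this
      simpa using this
    have : Ideal.Quotient.mk P (2 : 𝓞 M) = 0 := by
      rw [← h20, map_ofNat]
      norm_cast
    exact Ideal.Quotient.eq_zero_iff_mem.mp this
  have hodd' : ¬ 2 ∣ ringChar (𝓞 M ⧸ P) ^ (n : ℕ) := fun h => hodd (Nat.prime_two.dvd_of_dvd_pow h)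
  omega

/-- **A mover** (row R10b): if the nonarchimedean prime `A ≠ ⊤` of `ℚ̄` lies over the prime `P` of
`𝓞 M` (`M/ℚ` finite), `N(P)` is odd, and `b ∈ 𝓞 M` is congruent mod `P` to a NON-SQUARE unit residue
`t` (`t ^ ((N P - 1)/2) ≢ 1`), then some `φ ∈ D_A ∩ Γ_M` (an arithmetic Frobenius,
`exists_frobenius_of_below`) MOVES any square root `x` of `b`
(`smul_ne_self_of_sub_pow_mem_nonunits`, Euler's criterion).
[cite: NeukirchSchmidtWingberg2008, Thm (12.2.1)] [cite: NeukirchANT1999, Ch. V §3 Lemma (3.5)] -/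
theorem exists_mover {A : ValuationSubring (AlgebraicClosure ℚ)} (hA : A ≠ ⊤) {P : Ideal (𝓞 M)}
    (hPA : ∀ y : 𝓞 M, ((y : M) : AlgebraicClosure ℚ) ∈ A.nonunits ↔ y ∈ P)
    (hq : 2 ∣ Nat.card (𝓞 M ⧸ P) - 1) {b t : 𝓞 M} (hbt : b - t ∈ P) (ht : t ∉ P)
    (htpow : t ^ ((Nat.card (𝓞 M ⧸ P) - 1) / 2) - 1 ∉ P) {x : AlgebraicClosure ℚ}
    (hx : x ^ 2 = ((b : M) : AlgebraicClosure ℚ)) :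
    ∃ φ ∈ MulAction.stabilizer (absoluteGaloisGroup ℚ) A ⊓
        M.fixingSubgroup.comap (absoluteGaloisGroup.toAlgEquiv ℚ).toMonoidHom, φ • x ≠ x := by
  obtain ⟨φ, hφ, hfrob⟩ := exists_frobenius_of_below M hA hPA
  refine ⟨φ, hφ, ?_⟩
  set q := Nat.card (𝓞 M ⧸ P) with hqdef
  -- differences of non-units are non-units
  have hsub : ∀ {y z : AlgebraicClosure ℚ}, y ∈ A.nonunits → z ∈ A.nonunits → y - z ∈ A.nonunits := by
    intro y z hy hz
    rw [ValuationSubring.mem_nonunits_iff] at hy hz ⊢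
    exact lt_of_le_of_lt (A.valuation.map_sub y z) (max_lt hy hz)
  -- `b` is an integral unit of `A`
  have hbint : IsIntegral ℤ ((b : M) : AlgebraicClosure ℚ) :=
    (RingOfIntegers.isIntegral_coe b).map (IsScalarTower.toAlgHom ℤ M (AlgebraicClosure ℚ))
  have hxint : IsIntegral ℤ x := IsIntegral.of_pow two_pos (by rw [hx]; exact hbint)
  have hbA : ((b : M) : AlgebraicClosure ℚ) ∈ A :=
    coe_absIntegers_mem_valuationSubring A ⟨_, by
      rw [mem_integralClosure_iff]; exact hbint.tower_top⟩
  have hbu : ((b : M) : AlgebraicClosure ℚ) ∉ A.nonunits := by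
    rw [hPA]
    intro hb
    apply ht
    have : t = b - (b - t) := by ring
    rw [this]
    exact P.sub_mem hb hbt
  -- Euler: `b^{(q-1)/2} ≡ t^{(q-1)/2} ≢ 1 (mod 𝔪_A)`
  have hk : b ^ ((q - 1) / 2) - t ^ ((q - 1) / 2) ∈ P := by
    have hq' : Ideal.Quotient.mk P b = Ideal.Quotient.mk P t := Ideal.Quotient.eq.mpr hbt
    apply Ideal.Quotient.eq.mp
    rw [map_pow, map_pow, hq']
  have hbpow : ((b : M) : AlgebraicClosure ℚ) ^ ((q - 1) / 2) - 1 ∉ A.nonunits := by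
    intro h
    apply htpow
    rw [← hPA]
    have h1 : (((b ^ ((q - 1) / 2) - t ^ ((q - 1) / 2) : 𝓞 M) : M) : AlgebraicClosure ℚ) ∈ A.nonunits :=
      (hPA _).mpr hk
    have e : (((t ^ ((q - 1) / 2) - 1 : 𝓞 M) : M) : AlgebraicClosure ℚ) =
        (((b : M) : AlgebraicClosure ℚ) ^ ((q - 1) / 2) - 1) -
          (((b ^ ((q - 1) / 2) - t ^ ((q - 1) / 2) : 𝓞 M) : M) : AlgebraicClosure ℚ) := by
      push_cast
      ring
    rw [e]
    exact hsub h h1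
  exact smul_ne_self_of_sub_pow_mem_nonunits A two_ne_zero hx hbA hbu hq (hfrob x hxint) hbpow

/-- **Separation for ONE pair of primes** (row R10b ⇒ R9 with all data constructed): `β : V₁ ⥲ V₂`,
`M/ℚ` finite Galois inside `ℚ̄` with `Γ_M ≤ V₁ ∩ V₂`, `β(Γ_M ∩ V₁) = Γ_M ∩ V₂` with restriction `β_M`,
the invariance `β(Γ_L ∩ V₁) = Γ_L ∩ V₂` for every finite Galois `L` with `Γ_L ≤ Γ_M` (rows R4+R6),
two distinct ODD primes `v₀, v₁` of `ℚ` splitting completely in `M`, nonarchimedean primes `A, A'` of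
`ℚ̄` over them, and the correspondences `β_M(D_A ∩ Γ_M) = D_{m•A} ∩ Γ_M`,
`β_M(D_{A'} ∩ Γ_M) = D_{m'•A'} ∩ Γ_M`.  CONCLUSION: `m⁻¹ m' ∈ Γ_M` — row R9
(`inv_mul_mem_of_map_stabilizer_eq` at `ℓ = 2`, `ζ = -1`) fed with the Chinese-remainder element
(`exists_crt_element`), the movers (`exists_mover`), the Kummer field `M(√(Γ•b))`
(`comap_fixingSubgroup_sup_adjoin_rootSetOfOrbit`, `relIndex_comap_fixingSubgroup_dvd`,
abc-iut-w5-d047) and its `β`-invariance. [cite: NeukirchSchmidtWingberg2008, Thm (12.2.1)] -/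
theorem pair_separation {V₁ V₂ : Subgroup (absoluteGaloisGroup ℚ)} (β : V₁ ≃ₜ* V₂)
    (hMgal : IsGalois ℚ M) (hMV : ΓK M ≤ V₁)
    (βM : ΓK M ≃* ΓK M)
    (hβMv : ∀ h : ΓK M, ((βM h : ΓK M) : absoluteGaloisGroup ℚ) =
      ((β ⟨(h : absoluteGaloisGroup ℚ), hMV h.2⟩ : V₂) : absoluteGaloisGroup ℚ))
    (hinv : ∀ L : IntermediateField ℚ (AlgebraicClosure ℚ), FiniteDimensional ℚ L → IsGalois ℚ L →
      ΓK L ≤ ΓK M →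
        ((ΓK L).subgroupOf V₁).map β.toMulEquiv.toMonoidHom = (ΓK L).subgroupOf V₂)
    {v₀ v₁ : HeightOneSpectrum (𝓞 ℚ)} (hne : v₀ ≠ v₁) (h2₀ : (2 : 𝓞 ℚ) ∉ v₀.asIdeal)
    (h2₁ : (2 : 𝓞 ℚ) ∉ v₁.asIdeal) (hs₀ : v₀ ∈ splitPrimes ℚ M) (hs₁ : v₁ ∈ splitPrimes ℚ M)
    {A A' : ValuationSubring (AlgebraicClosure ℚ)} (hA : A ≠ ⊤) (hA' : A' ≠ ⊤)
    (hvA : ∀ r : 𝓞 ℚ, algebraMap ℚ (AlgebraicClosure ℚ) r ∈ A.nonunits ↔ r ∈ v₀.asIdeal)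
    (hvA' : ∀ r : 𝓞 ℚ, algebraMap ℚ (AlgebraicClosure ℚ) r ∈ A'.nonunits ↔ r ∈ v₁.asIdeal)
    {m m' : absoluteGaloisGroup ℚ}
    (hπ : ((MulAction.stabilizer (absoluteGaloisGroup ℚ) A).subgroupOf (ΓK M)).map βM.toMonoidHom =
      (MulAction.stabilizer (absoluteGaloisGroup ℚ) (m • A)).subgroupOf (ΓK M))
    (hπ' : ((MulAction.stabilizer (absoluteGaloisGroup ℚ) A').subgroupOf (ΓK M)).map βM.toMonoidHom =
      (MulAction.stabilizer (absoluteGaloisGroup ℚ) (m' • A')).subgroupOf (ΓK M)) :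
    m⁻¹ * m' ∈ ΓK M := by
  classical
  haveI : NumberField M := numberField_intermediateField M
  haveI : (ΓK M).Normal := normal_ΓK M hMgal
  -- the primes of `M` below `A`, `A'`; odd residue fields; non-square targets
  obtain ⟨P, hPA, -⟩ := existsUnique_ideal_below M A
  obtain ⟨P', hP'A, -⟩ := existsUnique_ideal_below M A'
  have hPmem := mem_primesOver_of_below M hA hPA hvA
  have hP'mem := mem_primesOver_of_below M hA' hP'A hvA'
  haveI : P.IsMaximal := Ideal.isMaximal_of_mem_primesOver hPmem
  haveI : P'.IsMaximal := Ideal.isMaximal_of_mem_primesOver hP'mem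
  obtain ⟨h2P, hq⟩ := two_dvd_card_quot_sub_one M h2₀ hPmem
  obtain ⟨h2P', hq'⟩ := two_dvd_card_quot_sub_one M h2₁ hP'mem
  obtain ⟨t, ht, htpow⟩ := exists_pow_div_sub_one_not_mem (q := P) Nat.prime_two hq
  obtain ⟨t', ht', htpow'⟩ := exists_pow_div_sub_one_not_mem (q := P') Nat.prime_two hq'
  -- the Chinese-remainder element
  obtain ⟨b, hbt, hbt', hg, hg'⟩ :=
    @exists_crt_element ℚ _ _ M _ hMgal _ _ hne hs₀ hs₁ _ _ hA hA' hvA hvA' _ _ hPA hP'A t t'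
  set βb : AlgebraicClosure ℚ := ((b : M) : AlgebraicClosure ℚ) with hβb
  have hβbM : βb ∈ M := (b : M).2
  have hβb0 : βb ≠ 0 := by
    intro h0
    apply ht
    have hbM : (b : M) = 0 := by
      rw [hβb] at h0
      exact_mod_cast h0
    have hb0 : b = 0 := by exact_mod_cast hbM
    have : t = -(b - t) := by rw [hb0]; ring
    rw [this]
    exact P.neg_mem hbt
  -- `ζ = -1`, square roots of the conjugates, the Kummer field
  have hζ : IsPrimitiveRoot (-1 : AlgebraicClosure ℚ) 2 := by
    haveI : CharP (AlgebraicClosure ℚ) 0 := CharP.ofCharZero _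
    exact IsPrimitiveRoot.neg_one 0 (by norm_num)
  have hζM : (-1 : AlgebraicClosure ℚ) ∈ M := M.neg_mem M.one_mem
  have hroot : ∀ c : AlgebraicClosure ℚ, ∃ y : AlgebraicClosure ℚ, y ^ 2 = c := fun c =>
    IsAlgClosed.exists_pow_nat_eq c two_pos
  choose x hx using hroot
  have hx' : ∀ c ∈ MulAction.orbit (absoluteGaloisGroup ℚ) βb, x c ^ 2 = c := fun c _ => hx c
  have hMstab : ∀ σ : absoluteGaloisGroup ℚ, ∀ y ∈ M, σ • y ∈ M := fun σ y hy =>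
    @forall_smul_mem_of_normal ℚ _ M hMgal.to_normal σ y hy
  have hcomap : ∀ (K : IntermediateField ℚ (AlgebraicClosure ℚ)) (σ : absoluteGaloisGroup ℚ),
      σ ∈ K.fixingSubgroup.comap (absoluteGaloisGroup.toAlgEquiv ℚ).toMonoidHom ↔ σ ∈ ΓK K :=
    fun K σ => (mem_comap_fixingSubgroup_iff K σ).trans (mem_ΓK_iff K σ).symm
  have hLfin : FiniteDimensional ℚ ↥(M ⊔ IntermediateField.adjoin ℚ
      {y : AlgebraicClosure ℚ | ∃ c ∈ MulAction.orbit (absoluteGaloisGroup ℚ) βb, y ^ 2 = c}) :=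
    finiteDimensional_rat_sup_adjoin_rootSetOfOrbit M two_pos βb
  have hLgal : IsGalois ℚ ↥(M ⊔ IntermediateField.adjoin ℚ
      {y : AlgebraicClosure ℚ | ∃ c ∈ MulAction.orbit (absoluteGaloisGroup ℚ) βb, y ^ 2 = c}) :=
    isGalois_rat_sup_adjoin_rootSetOfOrbit M hMstab βb 2
  have hW : ΓK (M ⊔ IntermediateField.adjoin ℚ
      {y : AlgebraicClosure ℚ | ∃ c ∈ MulAction.orbit (absoluteGaloisGroup ℚ) βb, y ^ 2 = c}) = ΓK M ⊓ ⨅ c ∈ MulAction.orbit (absoluteGaloisGroup ℚ) βb,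
      MulAction.stabilizer (absoluteGaloisGroup ℚ) (x c) := by
    have h := comap_fixingSubgroup_sup_adjoin_rootSetOfOrbit Nat.prime_two hζ M hζM βb x hx'
    ext σ
    have h1 := SetLike.ext_iff.mp h σ
    rw [Subgroup.mem_inf] at h1 ⊢
    constructor
    · intro hσ
      have h2 := h1.mp ((hcomap _ σ).mpr hσ)
      exact ⟨(hcomap M σ).mp h2.1, h2.2⟩
    · rintro ⟨hσM, hσx⟩
      exact (hcomap _ σ).mp (h1.mpr ⟨(hcomap M σ).mpr hσM, hσx⟩)
  have hWV : ΓK (M ⊔ IntermediateField.adjoin ℚ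
      {y : AlgebraicClosure ℚ | ∃ c ∈ MulAction.orbit (absoluteGaloisGroup ℚ) βb, y ^ 2 = c}) ≤ ΓK M := by rw [hW]; exact inf_le_left
  have hWx : ∀ w ∈ ΓK (M ⊔ IntermediateField.adjoin ℚ
      {y : AlgebraicClosure ℚ | ∃ c ∈ MulAction.orbit (absoluteGaloisGroup ℚ) βb, y ^ 2 = c}), ∀ c' ∈ MulAction.orbit (absoluteGaloisGroup ℚ) βb, w • x c' = x c' := by
    intro w hw c' hc'
    rw [hW, Subgroup.mem_inf, Subgroup.mem_iInf] at hw
    have := hw.2 c'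
    rw [Subgroup.mem_iInf] at this
    exact this hc'
  have hK2 : ∀ c ∈ MulAction.orbit (absoluteGaloisGroup ℚ) βb,
      (ΓK (M ⊔ IntermediateField.adjoin ℚ
      {y : AlgebraicClosure ℚ | ∃ c ∈ MulAction.orbit (absoluteGaloisGroup ℚ) βb, y ^ 2 = c})).relIndex (ΓK M ⊓ ⨅ c' ∈ MulAction.orbit (absoluteGaloisGroup ℚ) βb \ {c},
        MulAction.stabilizer (absoluteGaloisGroup ℚ) (x c')) ∣ 2 := by
    intro c hc
    have h := relIndex_comap_fixingSubgroup_dvd Nat.prime_two hζ M hMstab hζM hβbM hβb0 x hx' hc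
    convert h using 2
    · exact (Subgroup.ext (hcomap _)).symm
    · congr 1
  -- `β`-invariance of the Kummer field, restricted to `Γ_M`
  have hαW : ((ΓK (M ⊔ IntermediateField.adjoin ℚ
      {y : AlgebraicClosure ℚ | ∃ c ∈ MulAction.orbit (absoluteGaloisGroup ℚ) βb, y ^ 2 = c})).subgroupOf (ΓK M)).map βM.toMonoidHom =
      (ΓK (M ⊔ IntermediateField.adjoin ℚ
      {y : AlgebraicClosure ℚ | ∃ c ∈ MulAction.orbit (absoluteGaloisGroup ℚ) βb, y ^ 2 = c})).subgroupOf (ΓK M) :=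
    map_subgroupOf_restrict_of_le β.toMulEquiv hMV βM hβMv (hinv _ hLfin hLgal hWV)
  -- the data at `A` and at `A'`
  have e2cast : ((2 : ℕ) : AlgebraicClosure ℚ) = (((2 : 𝓞 M) : M) : AlgebraicClosure ℚ) := by norm_cast
  have hℓA : ((2 : ℕ) : AlgebraicClosure ℚ) ∉ A.nonunits := by
    rw [e2cast]
    exact (hPA 2).not.mpr h2P
  have hℓA' : ((2 : ℕ) : AlgebraicClosure ℚ) ∉ A'.nonunits := by
    rw [e2cast]
    exact (hP'A 2).not.mpr h2P'
  have hβA : ∀ g : absoluteGaloisGroup ℚ, g ∉ ΓK M → g • βb - 1 ∈ A.nonunits := fun g hgM =>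
    hg g fun h => hgM ((hcomap M g).mp h)
  have hβA' : ∀ g : absoluteGaloisGroup ℚ, g ∉ ΓK M → g • βb - 1 ∈ A'.nonunits := fun g hgM =>
    hg' g fun h => hgM ((hcomap M g).mp h)
  have hmoveA : ∃ φ ∈ MulAction.stabilizer (absoluteGaloisGroup ℚ) A ⊓ ΓK M, φ • x βb ≠ x βb := by
    obtain ⟨φ, hφ, hφx⟩ := exists_mover M hA hPA hq hbt ht htpow (hx βb)
    exact ⟨φ, ⟨hφ.1, (hcomap M φ).mp hφ.2⟩, hφx⟩
  have hmoveA' : ∃ φ ∈ MulAction.stabilizer (absoluteGaloisGroup ℚ) A' ⊓ ΓK M, φ • x βb ≠ x βb := by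
    obtain ⟨φ, hφ, hφx⟩ := exists_mover M hA' hP'A hq' hbt' ht' htpow' (hx βb)
    exact ⟨φ, ⟨hφ.1, (hcomap M φ).mp hφ.2⟩, hφx⟩
  -- row R9
  exact inv_mul_mem_of_map_stabilizer_eq (V := ΓK M) Nat.prime_two hζ
    (fun σ _ => by rw [smul_neg, smul_one])
    (fun σ hσ => (mem_ΓK_iff M σ).mp hσ βb hβbM) hx'
    (fun B σ hσ hσζ hℓB y c hy hσc hc =>
      smul_eq_self_of_pow_eq_of_sub_one_mem_nonunits B Nat.prime_two hζ hσ hσζ hℓB hy hσc hc)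
    hWV hWx hK2 βM hαW hℓA hℓA' hβA hβA' hmoveA hmoveA' hπ hπ'

end NeukirchUchidaProof

end Literature.AnabelianGeometry.AbsoluteAnabelian

end
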